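import Mathlib
import HarnessLib
import Literature.MathematicalPhysics.QuantumFieldTheory.GaussianToolkit
import Literature.Probability.Distributions.GaussianQuadraticTilt
import Literature.Analysis.Matrix.DetOneSubTraceBound

/-!
# Exponential moments of a centred Gaussian quadratic form, priced by the HILBERT–SCHMIDT norm
# ([Buc16] Thm 4.5 / Lemma 4.6 (Whittle), the dimension-free core)

[Buc16] Theorem 4.5 (= [ABKM19] Theorem 6.2) bounds the change of a Gaussian expectation
`∫ F dμ_{𝒞}` under a change of the covariance by `C_p ‖F‖_{L^p}` times the HILBERT–SCHMIDT norm
`‖𝒞^{-1/2} 𝒞̇ 𝒞^{-1/2}‖_{HS}` — a quantity that SUMS the squares of the per-mode relative changes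
instead of multiplying the dimension by their supremum; this is what makes the constant of [ABKM19]
Lemma 8.4 independent of the volume.  The probabilistic input is Whittle's inequality ([Buc16] Lemma 4.6):
the centred quadratic form `Q(y) = yᵀBy − E yᵀBy` of a Gaussian vector has all moments controlled by
`‖√S B √S‖_{HS}`.  This file proves the exponential-moment form of that input for Mathlib's
`multivariateGaussian 0 S` (`S ≻ 0`), by the tree's "general Gaussian calculus"
(`GaussianQuadraticTilt.integral_exp_half_quadratic_multivariateGaussian`: `E e^{½yᵀMy} = det(1 − SM)^{-1/2}`)
and eigenvalue bookkeeping: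

* matrix lemmas: `sq_eigenvalues_le_trace_mul_self` (`λᵢ² ≤ tr(T²)`; the identity `tr(T²) = Σλᵢ²` is the
  tree's `Literature.Geometry.Riemannian.AHRiccati.trace_mul_self_eq_sum_eigenvalues_sq`, whose module drags the
  Riemannian comparison-geometry stack into this file's imports — the five-line spectral computation is therefore
  repeated inside the two proofs that need it rather than imported or re-declared), `abs_dotProduct_mulVec_le_of_trace` (`|wᵀTw| ≤ h|w|²` when
  `tr(T²) ≤ h²`, by Cauchy–Schwarz);
* scalar lemmas: `neg_sub_two_sq_le_log_one_sub` (`−u − 2u² ≤ log(1−u)`, `|u| ≤ ½`),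
  `abs_rpow_le_mul_exp_add_exp` (`|x|^m ≤ (m/(e t))^m (e^{tx} + e^{−tx})`);
* **`integral_exp_mul_quadForm_sub_trace_le`** — for `S ≻ 0`, `B` symmetric, `T = √S B √S` with
  `tr(T²) ≤ h²` and `2|s|h ≤ ½`:  `E_{N(0,S)} e^{s (yᵀBy − tr T)} ≤ e^{4 s² h²}` (with integrability,
  `integrable_exp_mul_quadForm`), i.e. the MGF of the centred chaos is that of a sub-exponential variable
  of size `h`, uniformly in the dimension;
* **`integral_abs_quadForm_sub_trace_rpow_le`** — the moment form `E |yᵀBy − tr T|^m ≤ (4hm/e)^m · 2e`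
  (`m > 0`, `h > 0`).

Everything is proved; no named fact; finite-dimensional Gaussian calculus only.

## References
* S. Buchholz, *Finite range decomposition for Gaussian measures with improved regularity*,
  J. Funct. Anal. 275 (2018), Thm 4.5 and Lemma 4.6 (proof: (4.19), (4.20)) [Buchholz2016].
* S. Adams, S. Buchholz, R. Kotecký, S. Müller, arXiv:1910.13564, Theorem 6.2 [AdamsBuchholzKoteckyMuller2019].
-/

noncomputable section

namespace Literature.MathematicalPhysics.QuantumFieldTheory

open MeasureTheory ProbabilityTheory Matrix WithLp GaussianToolkit Unitary
open scoped ENNReal NNReal MatrixOrder BigOperators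

variable {ι : Type*} [Fintype ι] [DecidableEq ι]

/-! ## Matrix lemmas: the Hilbert–Schmidt norm of a symmetric matrix through its eigenvalues -/

/-- Each squared eigenvalue is at most `tr(T²)`. [cite: Buchholz2016, Lemma 4.6 (proof)] -/
theorem sq_eigenvalues_le_trace_mul_self {T : Matrix ι ι ℝ} (hT : T.IsHermitian) (i : ι) :
    hT.eigenvalues i ^ 2 ≤ (T * T).trace := by
  -- `tr(T²) = Σ λⱼ²` (spectral theorem; = the tree's `AHRiccati.trace_mul_self_eq_sum_eigenvalues_sq`)
  have htr : (T * T).trace = ∑ j, hT.eigenvalues j ^ 2 := by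
    have h := hT.spectral_theorem
    have hTT : T * T = conjStarAlgAut ℝ (Matrix ι ι ℝ) hT.eigenvectorUnitary
        (diagonal (RCLike.ofReal ∘ hT.eigenvalues) * diagonal (RCLike.ofReal ∘ hT.eigenvalues)) := by
      rw [map_mul, ← h]
    rw [hTT, conjStarAlgAut_apply, trace_mul_cycle, coe_star_mul_self, one_mul, diagonal_mul_diagonal,
      trace_diagonal]
    refine Finset.sum_congr rfl fun j _ => ?_
    simp [pow_two]
  rw [htr]
  exact Finset.single_le_sum (f := fun j => hT.eigenvalues j ^ 2) (fun j _ => sq_nonneg _)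
    (Finset.mem_univ i)

/-- `|λᵢ| ≤ h` whenever `tr(T²) ≤ h²`, `h ≥ 0`. [cite: Buchholz2016, Lemma 4.6 (proof)] -/
theorem abs_eigenvalues_le_of_trace {T : Matrix ι ι ℝ} (hT : T.IsHermitian) {h : ℝ} (hh : 0 ≤ h)
    (htr : (T * T).trace ≤ h ^ 2) (i : ι) : |hT.eigenvalues i| ≤ h :=
  abs_le_of_sq_le_sq ((sq_eigenvalues_le_trace_mul_self hT i).trans htr) hh

omit [DecidableEq ι] in
/-- `tr(TᵀT) = Σ_{a,b} T_{ab}²` (the Hilbert–Schmidt norm squared).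
[cite: Buchholz2016, Lemma 4.6 (proof: "‖A‖_HS = √tr AAᵀ")] -/
theorem trace_transpose_mul_self_eq_sum_sq (T : Matrix ι ι ℝ) :
    (Tᵀ * T).trace = ∑ a, ∑ b, T a b ^ 2 := by
  simp only [Matrix.trace, Matrix.diag, Matrix.mul_apply, Matrix.transpose_apply, pow_two]
  rw [Finset.sum_comm]

omit [DecidableEq ι] in
/-- **Cauchy–Schwarz form bound**: for a symmetric `T` with `tr(T²) ≤ h²`, `|wᵀTw| ≤ h·|w|²`
(the operator norm is at most the Hilbert–Schmidt norm; elementary step of the proof).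
[cite: Buchholz2016, Thm 4.5 (proof)] -/
theorem abs_dotProduct_mulVec_le_of_trace {T : Matrix ι ι ℝ} (hTt : Tᵀ = T) {h : ℝ} (hh : 0 ≤ h)
    (htr : (T * T).trace ≤ h ^ 2) (w : ι → ℝ) :
    |w ⬝ᵥ T *ᵥ w| ≤ h * (w ⬝ᵥ w) := by
  have hsum : ∑ a, ∑ b, T a b ^ 2 ≤ h ^ 2 := by
    rw [← trace_transpose_mul_self_eq_sum_sq, hTt]; exact htr
  have hw0 : 0 ≤ w ⬝ᵥ w := by
    simp only [dotProduct, ← pow_two]; exact Finset.sum_nonneg fun i _ => sq_nonneg _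
  -- `|Tw|² ≤ (Σ T_ab²) |w|²`
  have hTw : (T *ᵥ w) ⬝ᵥ (T *ᵥ w) ≤ h ^ 2 * (w ⬝ᵥ w) := by
    have h1 : ∀ a, (T *ᵥ w) a ^ 2 ≤ (∑ b, T a b ^ 2) * (w ⬝ᵥ w) := by
      intro a
      have := Finset.sum_mul_sq_le_sq_mul_sq Finset.univ (fun b => T a b) w
      simpa [Matrix.mulVec, dotProduct, pow_two] using this
    calc (T *ᵥ w) ⬝ᵥ (T *ᵥ w) = ∑ a, (T *ᵥ w) a ^ 2 := by simp [dotProduct, pow_two]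
      _ ≤ ∑ a, (∑ b, T a b ^ 2) * (w ⬝ᵥ w) := Finset.sum_le_sum fun a _ => h1 a
      _ = (∑ a, ∑ b, T a b ^ 2) * (w ⬝ᵥ w) := by rw [Finset.sum_mul]
      _ ≤ h ^ 2 * (w ⬝ᵥ w) := mul_le_mul_of_nonneg_right hsum hw0
  -- `|w · Tw|² ≤ |w|² |Tw|²`
  have hcs : (w ⬝ᵥ T *ᵥ w) ^ 2 ≤ (w ⬝ᵥ w) * ((T *ᵥ w) ⬝ᵥ (T *ᵥ w)) := by
    have := Finset.sum_mul_sq_le_sq_mul_sq Finset.univ w (T *ᵥ w)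
    simpa [dotProduct, pow_two] using this
  have hsq : (w ⬝ᵥ T *ᵥ w) ^ 2 ≤ (h * (w ⬝ᵥ w)) ^ 2 := by
    calc (w ⬝ᵥ T *ᵥ w) ^ 2 ≤ (w ⬝ᵥ w) * ((T *ᵥ w) ⬝ᵥ (T *ᵥ w)) := hcs
      _ ≤ (w ⬝ᵥ w) * (h ^ 2 * (w ⬝ᵥ w)) := mul_le_mul_of_nonneg_left hTw hw0
      _ = (h * (w ⬝ᵥ w)) ^ 2 := by ring
  exact abs_le_of_sq_le_sq hsq (mul_nonneg hh hw0)

/-! ## Scalar lemmas -/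

omit [Fintype ι] [DecidableEq ι] in
/-- `−u − 2u² ≤ log(1 − u)` for `|u| ≤ ½` (from `1 − x⁻¹ ≤ log x`; elementary step bounding
`log det(1 − M) = Σ log(1 − λᵢ)` from below). [cite: Buchholz2016, Thm 4.5 (proof)] -/
theorem neg_sub_two_sq_le_log_one_sub {u : ℝ} (hu : |u| ≤ 1 / 2) :
    -u - 2 * u ^ 2 ≤ Real.log (1 - u) := by
  have hu1 := (abs_le.1 hu).1
  have hu2 := (abs_le.1 hu).2
  have hpos : 0 < 1 - u := by linarith
  have h1 : 1 - (1 - u)⁻¹ ≤ Real.log (1 - u) := Real.one_sub_inv_le_log_of_pos hpos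
  have h2 : -u - 2 * u ^ 2 ≤ 1 - (1 - u)⁻¹ := by
    rw [show 1 - (1 - u)⁻¹ = -u / (1 - u) by field_simp; ring]
    rw [le_div_iff₀ hpos]
    nlinarith [sq_nonneg u]
  exact h2.trans h1

omit [Fintype ι] [DecidableEq ι] in
/-- `log(1 − u) ≤ −u` for `u < 1` (elementary step bounding `log det(1 − M)` from above).
[cite: Buchholz2016, Thm 4.5 (proof)] -/
theorem log_one_sub_le_neg {u : ℝ} (hu : u < 1) : Real.log (1 - u) ≤ -u := by
  have := Real.log_le_sub_one_of_pos (show (0 : ℝ) < 1 - u by linarith)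
  linarith

omit [Fintype ι] [DecidableEq ι] in
/-- For `|u| ≤ ½`: `e^{−u − 2u²} ≤ 1 − u` (exponentiated form of the previous step).
[cite: Buchholz2016, Thm 4.5 (proof)] -/
theorem exp_neg_sub_two_sq_le_one_sub {u : ℝ} (hu : |u| ≤ 1 / 2) :
    Real.exp (-u - 2 * u ^ 2) ≤ 1 - u := by
  have hpos : 0 < 1 - u := by linarith [(abs_le.1 hu).2]
  calc Real.exp (-u - 2 * u ^ 2) ≤ Real.exp (Real.log (1 - u)) :=
        Real.exp_le_exp.2 (neg_sub_two_sq_le_log_one_sub hu)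
    _ = 1 - u := Real.exp_log hpos

omit [Fintype ι] [DecidableEq ι] in
/-- **Moments from exponential moments**: `|x|^m ≤ (m/(e·t))^m · (e^{tx} + e^{−tx})` for `t > 0`,
`m > 0` (from `e·y ≤ e^y`). [cite: Buchholz2016, Lemma 4.6 (proof: Hölder)] -/
theorem abs_rpow_le_mul_exp_add_exp {t m : ℝ} (ht : 0 < t) (hm : 0 < m) (x : ℝ) :
    |x| ^ m ≤ (m / (Real.exp 1 * t)) ^ m * (Real.exp (t * x) + Real.exp (-(t * x))) := by
  have he : 0 < Real.exp 1 := Real.exp_pos 1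
  set y : ℝ := t * |x| with hy
  have hy0 : 0 ≤ y := by positivity
  -- `y^m ≤ (m/e)^m e^y`
  have hkey : y ^ m ≤ (m / Real.exp 1) ^ m * Real.exp y := by
    have h1 : Real.exp 1 * (y / m) ≤ Real.exp (y / m) := Real.exp_one_mul_le_exp
    have h2 : 0 ≤ Real.exp 1 * (y / m) := by positivity
    have h3 : (Real.exp 1 * (y / m)) ^ m ≤ (Real.exp (y / m)) ^ m :=
      Real.rpow_le_rpow h2 h1 hm.le
    have h4 : (Real.exp (y / m)) ^ m = Real.exp y := by
      rw [← Real.exp_mul]; congr 1; field_simp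
    have h5 : y = (m / Real.exp 1) * (Real.exp 1 * (y / m)) := by field_simp
    calc y ^ m = ((m / Real.exp 1) * (Real.exp 1 * (y / m))) ^ m := by rw [← h5]
      _ = (m / Real.exp 1) ^ m * (Real.exp 1 * (y / m)) ^ m := Real.mul_rpow (by positivity) h2
      _ ≤ (m / Real.exp 1) ^ m * Real.exp y := by
          rw [← h4]; exact mul_le_mul_of_nonneg_left h3 (by positivity)
  -- `|x| = y/t`
  have hx : |x| = (1 / t) * y := by rw [hy]; field_simp
  have hexp : Real.exp y ≤ Real.exp (t * x) + Real.exp (-(t * x)) := by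
    rcases le_or_gt 0 x with hx0 | hx0
    · rw [hy, abs_of_nonneg hx0]; linarith [Real.exp_pos (-(t * x))]
    · rw [hy, abs_of_neg hx0, show t * -x = -(t * x) by ring]; linarith [Real.exp_pos (t * x)]
  calc |x| ^ m = ((1 / t) * y) ^ m := by rw [hx]
    _ = (1 / t) ^ m * y ^ m := Real.mul_rpow (by positivity) hy0
    _ ≤ (1 / t) ^ m * ((m / Real.exp 1) ^ m * Real.exp y) :=
        mul_le_mul_of_nonneg_left hkey (by positivity)
    _ = ((1 / t) * (m / Real.exp 1)) ^ m * Real.exp y := by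
        rw [Real.mul_rpow (by positivity) (by positivity)]; ring
    _ = (m / (Real.exp 1 * t)) ^ m * Real.exp y := by
        congr 2; field_simp
    _ ≤ (m / (Real.exp 1 * t)) ^ m * (Real.exp (t * x) + Real.exp (-(t * x))) :=
        mul_le_mul_of_nonneg_left hexp (by positivity)

/-! ## The exponential moment of the centred quadratic form -/

/-- The sandwiched matrix `T = √S B √S` is symmetric for symmetric `B`. [cite: Buchholz2016, Thm 4.5 (proof)] -/
theorem isHermitian_sqrt_mul_mul_sqrt (S : Matrix ι ι ℝ) {B : Matrix ι ι ℝ} (hB : Bᵀ = B) :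
    (CFC.sqrt S * B * CFC.sqrt S).IsHermitian := by
  have hBh : B.IsHermitian := by
    show Bᴴ = B; rw [Matrix.conjTranspose_eq_transpose_of_trivial, hB]
  have hT : (CFC.sqrt S)ᴴ = CFC.sqrt S := by
    rw [Matrix.conjTranspose_eq_transpose_of_trivial, transpose_sqrt]
  have := Matrix.isHermitian_mul_mul_conjTranspose (CFC.sqrt S) hBh
  rwa [hT] at this

/-- For symmetric `T` with `tr(T²) ≤ h²` and `2|s|h ≤ ½`: `1 − 2sT ≻ 0` (indeed `≥ ½`).
[cite: Buchholz2016, Thm 4.5 (proof)] -/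
theorem posDef_one_sub_smul_of_trace {T : Matrix ι ι ℝ} (hT : T.IsHermitian) {h s : ℝ} (hh : 0 ≤ h)
    (htr : (T * T).trace ≤ h ^ 2) (hs : 2 * |s| * h ≤ 1 / 2) :
    ((1 : Matrix ι ι ℝ) - (2 * s) • T).PosDef := by
  have hTt : Tᵀ = T := by
    have := hT.eq; rwa [Matrix.conjTranspose_eq_transpose_of_trivial] at this
  refine Matrix.PosDef.of_dotProduct_mulVec_pos ?_ fun x hx => ?_
  · have h1 : ((2 * s) • T).IsHermitian := by
      show ((2 * s) • T)ᴴ = (2 * s) • T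
      rw [Matrix.conjTranspose_smul, hT.eq]; simp
    exact Matrix.isHermitian_one.sub h1
  · have hxx : 0 < x ⬝ᵥ x := by
      have h0 : 0 ≤ x ⬝ᵥ x := by
        simp only [dotProduct, ← pow_two]; exact Finset.sum_nonneg fun i _ => sq_nonneg _
      rcases h0.eq_or_lt with h | h
      · exfalso; apply hx
        have : x ⬝ᵥ x = 0 := h.symm
        exact dotProduct_self_eq_zero.1 this
      · exact h
    have hform := abs_dotProduct_mulVec_le_of_trace hTt hh htr x
    have hstar : star x = x := by ext i; simp
    rw [hstar, Matrix.sub_mulVec, Matrix.one_mulVec, dotProduct_sub, Matrix.smul_mulVec,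
      dotProduct_smul, smul_eq_mul]
    have h2 : |2 * s * (x ⬝ᵥ T *ᵥ x)| ≤ 1 / 2 * (x ⬝ᵥ x) := by
      rw [abs_mul, abs_mul, abs_two]
      calc 2 * |s| * |x ⬝ᵥ T *ᵥ x| ≤ 2 * |s| * (h * (x ⬝ᵥ x)) :=
            mul_le_mul_of_nonneg_left hform (by positivity)
        _ = (2 * |s| * h) * (x ⬝ᵥ x) := by ring
        _ ≤ 1 / 2 * (x ⬝ᵥ x) := mul_le_mul_of_nonneg_right hs hxx.le
    have := (abs_le.1 h2).2
    linarith

/-- **Integrability of `e^{s yᵀBy}` under `N(0,S)`** for `S ≻ 0`, `B` symmetric, `tr((√S B √S)²) ≤ h²`,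
`2|s|h ≤ ½`. [cite: Buchholz2016, Thm 4.5 (proof)] -/
theorem integrable_exp_mul_quadForm {S : Matrix ι ι ℝ} {B : Matrix ι ι ℝ} (hB : Bᵀ = B)
    {h s : ℝ} (hh : 0 ≤ h)
    (htr : ((CFC.sqrt S * B * CFC.sqrt S) * (CFC.sqrt S * B * CFC.sqrt S)).trace ≤ h ^ 2)
    (hs : 2 * |s| * h ≤ 1 / 2) :
    Integrable (fun y : EuclideanSpace ℝ ι => Real.exp (s * (ofLp y ⬝ᵥ B *ᵥ ofLp y)))
      (multivariateGaussian 0 S) := by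
  have hT := isHermitian_sqrt_mul_mul_sqrt S hB
  have hM : ((2 * s) • B)ᵀ = (2 * s) • B := by rw [Matrix.transpose_smul, hB]
  have hsub : ((1 : Matrix ι ι ℝ) - CFC.sqrt S * ((2 * s) • B) * CFC.sqrt S).PosDef := by
    rw [Matrix.mul_smul, Matrix.smul_mul]
    exact posDef_one_sub_smul_of_trace hT hh htr hs
  have hint := Literature.Probability.Distributions.integrable_exp_half_quadratic_shift_multivariateGaussian
    (S := S) hM hsub 0
  refine hint.congr (Filter.Eventually.of_forall fun y => ?_)
  simp only [add_zero, Matrix.smul_mulVec, dotProduct_smul, smul_eq_mul]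
  congr 1; ring

/-- **The exponential moment of the centred Gaussian quadratic form, priced by the Hilbert–Schmidt norm**
([Buc16] Lemma 4.6 / Thm 4.5, dimension-free core).  For `S ≻ 0`, `B` symmetric, `T = √S B √S` with
`tr(T²) ≤ h²` (`h ≥ 0`) and `2|s|h ≤ ½`:
`E_{N(0,S)} exp(s·(yᵀBy − tr T)) ≤ exp(4 s² h²)`.
Proof: `E e^{s yᵀBy} = det(1 − 2sT)^{-1/2} = Π(1 − 2sλᵢ)^{-1/2}` and `−log(1−u) ≤ u + 2u²` for `|u| ≤ ½`,
with `Σλᵢ = tr T`, `Σλᵢ² = tr(T²)`. [cite: Buchholz2016, Lemma 4.6] -/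
theorem integral_exp_mul_quadForm_sub_trace_le {S : Matrix ι ι ℝ} (hS : S.PosDef) {B : Matrix ι ι ℝ}
    (hB : Bᵀ = B) {h s : ℝ} (hh : 0 ≤ h)
    (htr : ((CFC.sqrt S * B * CFC.sqrt S) * (CFC.sqrt S * B * CFC.sqrt S)).trace ≤ h ^ 2)
    (hs : 2 * |s| * h ≤ 1 / 2) :
    ∫ y, Real.exp (s * (ofLp y ⬝ᵥ B *ᵥ ofLp y - (CFC.sqrt S * B * CFC.sqrt S).trace))
        ∂(multivariateGaussian 0 S) ≤ Real.exp (4 * s ^ 2 * h ^ 2) := by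
  set T : Matrix ι ι ℝ := CFC.sqrt S * B * CFC.sqrt S with hTdef
  have hT : T.IsHermitian := isHermitian_sqrt_mul_mul_sqrt S hB
  have hM : ((2 * s) • B)ᵀ = (2 * s) • B := by rw [Matrix.transpose_smul, hB]
  have hsm : CFC.sqrt S * ((2 * s) • B) * CFC.sqrt S = (2 * s) • T := by
    rw [Matrix.mul_smul, Matrix.smul_mul]
  have hsub : ((1 : Matrix ι ι ℝ) - CFC.sqrt S * ((2 * s) • B) * CFC.sqrt S).PosDef := by
    rw [hsm]; exact posDef_one_sub_smul_of_trace hT hh htr hs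
  -- the regulator formula
  have hreg := Literature.Probability.Distributions.integral_exp_half_quadratic_multivariateGaussian
    (S := S) hS.posSemidef hM hsub
  have hfun : ∀ y : EuclideanSpace ℝ ι, Real.exp ((ofLp y ⬝ᵥ ((2 * s) • B) *ᵥ ofLp y) / 2) =
      Real.exp (s * (ofLp y ⬝ᵥ B *ᵥ ofLp y)) := by
    intro y
    simp only [Matrix.smul_mulVec, dotProduct_smul, smul_eq_mul]
    congr 1; ring
  simp_rw [hfun] at hreg
  -- `det(1 − S(2sB)) = det(1 − 2sT)`
  have hdet : ((1 : Matrix ι ι ℝ) - S * ((2 * s) • B)).det = ((1 : Matrix ι ι ℝ) - (2 * s) • T).det := by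
    rw [← Literature.Probability.Distributions.det_one_sub_sqrt_mul_sqrt (sqrt_mul_sqrt hS) ((2 * s) • B), hsm]
  -- eigenvalues of `M' = 2sT`
  set M' : Matrix ι ι ℝ := (2 * s) • T with hM'def
  have hM' : M'.IsHermitian := by
    show ((2 * s) • T)ᴴ = (2 * s) • T
    rw [Matrix.conjTranspose_smul, hT.eq]; simp
  have htrM' : M'.trace = 2 * s * T.trace := by rw [hM'def, Matrix.trace_smul, smul_eq_mul]
  have htrM'2 : (M' * M').trace = (2 * s) ^ 2 * (T * T).trace := by
    rw [hM'def, Matrix.smul_mul, Matrix.mul_smul, smul_smul, Matrix.trace_smul, smul_eq_mul, pow_two]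
  have htrM'2le : (M' * M').trace ≤ (1 / 2) ^ 2 := by
    rw [htrM'2]
    calc (2 * s) ^ 2 * (T * T).trace ≤ (2 * s) ^ 2 * h ^ 2 :=
          mul_le_mul_of_nonneg_left htr (sq_nonneg _)
      _ = (2 * |s| * h) ^ 2 := by rw [mul_pow, mul_pow, mul_pow, sq_abs]
      _ ≤ (1 / 2) ^ 2 := pow_le_pow_left₀ (by positivity) hs 2
  have hμ : ∀ i, |hM'.eigenvalues i| ≤ 1 / 2 :=
    abs_eigenvalues_le_of_trace hM' (by norm_num) htrM'2le
  -- `det(1 − M') ≥ exp(−tr M' − 2 tr M'²) > 0`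
  have hdetprod : ((1 : Matrix ι ι ℝ) - M').det = ∏ i, (1 - hM'.eigenvalues i) :=
    Literature.Analysis.Matrix.det_one_sub_eq_prod_one_sub_eigenvalues hM'
  have hlow : Real.exp (-M'.trace - 2 * (M' * M').trace) ≤ ((1 : Matrix ι ι ℝ) - M').det := by
    have htr2 : (M' * M').trace = ∑ j, hM'.eigenvalues j ^ 2 := by
      have hsp := hM'.spectral_theorem
      have hMM : M' * M' = conjStarAlgAut ℝ (Matrix ι ι ℝ) hM'.eigenvectorUnitary
          (diagonal (RCLike.ofReal ∘ hM'.eigenvalues) * diagonal (RCLike.ofReal ∘ hM'.eigenvalues)) := by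
        rw [map_mul, ← hsp]
      rw [hMM, conjStarAlgAut_apply, trace_mul_cycle, coe_star_mul_self, one_mul, diagonal_mul_diagonal,
        trace_diagonal]
      refine Finset.sum_congr rfl fun j _ => ?_
      simp [pow_two]
    rw [hdetprod, hM'.trace_eq_sum_eigenvalues, htr2]
    have : Real.exp (-(∑ i, (hM'.eigenvalues i : ℝ)) - 2 * ∑ i, hM'.eigenvalues i ^ 2) =
        ∏ i, Real.exp (-hM'.eigenvalues i - 2 * hM'.eigenvalues i ^ 2) := by
      rw [← Real.exp_sum]; congr 1
      rw [Finset.mul_sum, ← Finset.sum_neg_distrib, ← Finset.sum_sub_distrib]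
    simp only [RCLike.ofReal_real_eq_id, id_eq] at this ⊢
    rw [this]
    exact Finset.prod_le_prod (fun i _ => (Real.exp_pos _).le)
      (fun i _ => exp_neg_sub_two_sq_le_one_sub (hμ i))
  have hdetpos : 0 < ((1 : Matrix ι ι ℝ) - M').det := lt_of_lt_of_le (Real.exp_pos _) hlow
  -- assemble: `∫ e^{s u} = (√det)⁻¹ ≤ exp(½ tr M' + tr M'²) ≤ exp(s tr T + 4 s² h²)`
  have hI : ∫ y, Real.exp (s * (ofLp y ⬝ᵥ B *ᵥ ofLp y)) ∂(multivariateGaussian 0 S)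
      ≤ Real.exp (s * T.trace + 4 * s ^ 2 * h ^ 2) := by
    rw [hreg, hdet]
    have h1 : 1 / Real.sqrt (((1 : Matrix ι ι ℝ) - M').det)
        ≤ 1 / Real.sqrt (Real.exp (-M'.trace - 2 * (M' * M').trace)) :=
      one_div_le_one_div_of_le (Real.sqrt_pos.2 (Real.exp_pos _)) (Real.sqrt_le_sqrt hlow)
    refine h1.trans ?_
    rw [← Real.exp_half, one_div, ← Real.exp_neg]
    refine Real.exp_le_exp.2 ?_
    rw [htrM', htrM'2]
    have : (2 * s) ^ 2 * (T * T).trace ≤ 4 * s ^ 2 * h ^ 2 := by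
      calc (2 * s) ^ 2 * (T * T).trace ≤ (2 * s) ^ 2 * h ^ 2 :=
            mul_le_mul_of_nonneg_left htr (sq_nonneg _)
        _ = 4 * s ^ 2 * h ^ 2 := by ring
    linarith
  have hsplit : ∀ y : EuclideanSpace ℝ ι,
      Real.exp (s * (ofLp y ⬝ᵥ B *ᵥ ofLp y - T.trace)) =
        Real.exp (-(s * T.trace)) * Real.exp (s * (ofLp y ⬝ᵥ B *ᵥ ofLp y)) := by
    intro y; rw [← Real.exp_add]; congr 1; ring
  simp_rw [hsplit]
  rw [integral_const_mul]
  calc Real.exp (-(s * T.trace)) * ∫ y, Real.exp (s * (ofLp y ⬝ᵥ B *ᵥ ofLp y)) ∂(multivariateGaussian 0 S)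
      ≤ Real.exp (-(s * T.trace)) * Real.exp (s * T.trace + 4 * s ^ 2 * h ^ 2) :=
        mul_le_mul_of_nonneg_left hI (Real.exp_pos _).le
    _ = Real.exp (4 * s ^ 2 * h ^ 2) := by rw [← Real.exp_add]; congr 1; ring

/-- **Both-sided exponential moment**: under the same hypotheses with `t > 0`, `2th ≤ ½`,
`E_{N(0,S)} [e^{tQ} + e^{−tQ}] ≤ 2e` where `Q = yᵀBy − tr T` (we use `4t²h² ≤ 1`).
[cite: Buchholz2016, Lemma 4.6] -/
theorem integral_exp_add_exp_quadForm_sub_trace_le {S : Matrix ι ι ℝ} (hS : S.PosDef) {B : Matrix ι ι ℝ}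
    (hB : Bᵀ = B) {h t : ℝ} (hh : 0 ≤ h)
    (htr : ((CFC.sqrt S * B * CFC.sqrt S) * (CFC.sqrt S * B * CFC.sqrt S)).trace ≤ h ^ 2)
    (ht : 0 ≤ t) (hth : 2 * t * h ≤ 1 / 2) :
    ∫ y, (Real.exp (t * (ofLp y ⬝ᵥ B *ᵥ ofLp y - (CFC.sqrt S * B * CFC.sqrt S).trace)) +
        Real.exp (-(t * (ofLp y ⬝ᵥ B *ᵥ ofLp y - (CFC.sqrt S * B * CFC.sqrt S).trace))))
        ∂(multivariateGaussian 0 S) ≤ 2 * Real.exp 1 := by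
  set T : Matrix ι ι ℝ := CFC.sqrt S * B * CFC.sqrt S with hTdef
  have hs1 : 2 * |t| * h ≤ 1 / 2 := by rwa [abs_of_nonneg ht]
  have hs2 : 2 * |(-t)| * h ≤ 1 / 2 := by rwa [abs_neg, abs_of_nonneg ht]
  have hint : ∀ s : ℝ, 2 * |s| * h ≤ 1 / 2 →
      Integrable (fun y : EuclideanSpace ℝ ι => Real.exp (s * (ofLp y ⬝ᵥ B *ᵥ ofLp y - T.trace)))
        (multivariateGaussian 0 S) := by
    intro s hs'
    have := (integrable_exp_mul_quadForm hB hh htr hs').const_mul (Real.exp (-(s * T.trace)))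
    refine this.congr (Filter.Eventually.of_forall fun y => ?_)
    simp only []
    rw [← Real.exp_add]; congr 1; ring
  have e4 : Real.exp (4 * t ^ 2 * h ^ 2) ≤ Real.exp 1 := by
    refine Real.exp_le_exp.2 ?_
    have : (2 * t * h) ^ 2 ≤ (1 / 2) ^ 2 := pow_le_pow_left₀ (by positivity) hth 2
    nlinarith
  have h1 := integral_exp_mul_quadForm_sub_trace_le hS hB hh htr hs1
  have h2 := integral_exp_mul_quadForm_sub_trace_le hS hB hh htr hs2
  have hneg : ∀ y : EuclideanSpace ℝ ι, Real.exp (-(t * (ofLp y ⬝ᵥ B *ᵥ ofLp y - T.trace))) =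
      Real.exp ((-t) * (ofLp y ⬝ᵥ B *ᵥ ofLp y - T.trace)) := fun y => by congr 1; ring
  simp_rw [hneg]
  rw [integral_add (hint t hs1) (hint (-t) hs2)]
  have e4' : Real.exp (4 * (-t) ^ 2 * h ^ 2) ≤ Real.exp 1 := by rwa [neg_sq]
  linarith [h1.trans e4, h2.trans e4']

/-- **Whittle's inequality, moment form** ([Buc16] Lemma 4.6): for `S ≻ 0`, `B` symmetric, `T = √S B √S`
with `tr(T²) ≤ h²`, `h > 0`, and a real exponent `m > 0`,
`E_{N(0,S)} |yᵀBy − tr T|^m ≤ (4hm/e)^m · 2e` — all moments of the centred quadratic chaos are those of a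
variable of size `h`, uniformly in the dimension. [cite: Buchholz2016, Lemma 4.6] -/
theorem integral_abs_quadForm_sub_trace_rpow_le {S : Matrix ι ι ℝ} (hS : S.PosDef) {B : Matrix ι ι ℝ}
    (hB : Bᵀ = B) {h m : ℝ} (hh : 0 < h)
    (htr : ((CFC.sqrt S * B * CFC.sqrt S) * (CFC.sqrt S * B * CFC.sqrt S)).trace ≤ h ^ 2)
    (hm : 0 < m) :
    ∫ y, |ofLp y ⬝ᵥ B *ᵥ ofLp y - (CFC.sqrt S * B * CFC.sqrt S).trace| ^ m
        ∂(multivariateGaussian 0 S) ≤ (4 * h * m / Real.exp 1) ^ m * (2 * Real.exp 1) := by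
  set T : Matrix ι ι ℝ := CFC.sqrt S * B * CFC.sqrt S with hTdef
  set t : ℝ := 1 / (4 * h) with htdef
  have ht : 0 < t := by positivity
  have hth : 2 * t * h ≤ 1 / 2 := by rw [htdef]; field_simp; norm_num
  have hpt : ∀ y : EuclideanSpace ℝ ι, |ofLp y ⬝ᵥ B *ᵥ ofLp y - T.trace| ^ m ≤
      (m / (Real.exp 1 * t)) ^ m * (Real.exp (t * (ofLp y ⬝ᵥ B *ᵥ ofLp y - T.trace)) +
        Real.exp (-(t * (ofLp y ⬝ᵥ B *ᵥ ofLp y - T.trace)))) :=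
    fun y => abs_rpow_le_mul_exp_add_exp ht hm _
  have hconst : m / (Real.exp 1 * t) = 4 * h * m / Real.exp 1 := by
    rw [htdef]; field_simp
  have hE := integral_exp_add_exp_quadForm_sub_trace_le hS hB hh.le htr ht.le hth
  -- integrability of the dominating function
  have hs1 : 2 * |t| * h ≤ 1 / 2 := by rwa [abs_of_nonneg ht.le]
  have hs2 : 2 * |(-t)| * h ≤ 1 / 2 := by rwa [abs_neg, abs_of_nonneg ht.le]
  have hint : ∀ s : ℝ, 2 * |s| * h ≤ 1 / 2 →
      Integrable (fun y : EuclideanSpace ℝ ι => Real.exp (s * (ofLp y ⬝ᵥ B *ᵥ ofLp y - T.trace)))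
        (multivariateGaussian 0 S) := by
    intro s hs'
    have := (integrable_exp_mul_quadForm hB hh.le htr hs').const_mul (Real.exp (-(s * T.trace)))
    refine this.congr (Filter.Eventually.of_forall fun y => ?_)
    simp only []
    rw [← Real.exp_add]; congr 1; ring
  have hdom : Integrable (fun y : EuclideanSpace ℝ ι =>
      (m / (Real.exp 1 * t)) ^ m * (Real.exp (t * (ofLp y ⬝ᵥ B *ᵥ ofLp y - T.trace)) +
        Real.exp (-(t * (ofLp y ⬝ᵥ B *ᵥ ofLp y - T.trace))))) (multivariateGaussian 0 S) := by
    refine ((hint t hs1).add ?_).const_mul _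
    refine (hint (-t) hs2).congr (Filter.Eventually.of_forall fun y => ?_)
    simp only []; congr 1; ring
  calc ∫ y, |ofLp y ⬝ᵥ B *ᵥ ofLp y - T.trace| ^ m ∂(multivariateGaussian 0 S)
      ≤ ∫ y, (m / (Real.exp 1 * t)) ^ m * (Real.exp (t * (ofLp y ⬝ᵥ B *ᵥ ofLp y - T.trace)) +
          Real.exp (-(t * (ofLp y ⬝ᵥ B *ᵥ ofLp y - T.trace)))) ∂(multivariateGaussian 0 S) :=
        integral_mono_of_nonneg (Filter.Eventually.of_forall fun y => by positivity) hdom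
          (Filter.Eventually.of_forall hpt)
    _ = (m / (Real.exp 1 * t)) ^ m * ∫ y, (Real.exp (t * (ofLp y ⬝ᵥ B *ᵥ ofLp y - T.trace)) +
          Real.exp (-(t * (ofLp y ⬝ᵥ B *ᵥ ofLp y - T.trace)))) ∂(multivariateGaussian 0 S) :=
        integral_const_mul _ _
    _ ≤ (m / (Real.exp 1 * t)) ^ m * (2 * Real.exp 1) :=
        mul_le_mul_of_nonneg_left hE (by positivity)
    _ = (4 * h * m / Real.exp 1) ^ m * (2 * Real.exp 1) := by rw [hconst]

end Literature.MathematicalPhysics.QuantumFieldTheory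

end
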